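import Mathlib
import HarnessLib
import Summits.HubbardSuperconductivity.HubbardSuperconductivity.Theorems.KLProgrammeKLRegimeSplitGlueP4
import Summits.HubbardSuperconductivity.HubbardSuperconductivity.Theorems.KLProgrammeKLRegimeVolumeLimitExDefs
import Summits.HubbardSuperconductivity.HubbardSuperconductivity.Theorems.KLProgrammeKLRegimeSplitBundleV14

/-!
# Route `KLProgramme` — the K3-NAMED glue of the five gen-5 children at `klPredsV14` with the ∃-threshold volume-limit slot
# `FinalTwoLegVolLimitEx` (stmt-HubbardSuperconductivity-19937; DOWNSTREAM of the route file; cell gate-hubbard-kl, seat p2 g7 on plan2 g4's kit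
# STATUS l.1633 «ANY PROVER HAND (GlueV14P4Ex — file right after BundleV14 is ACCEPTED)»)

`KLRegimeInductionV14P4Ex := KLRegimeInductionP4 klPredsV14 FinalTwoLegVolLimitEx` (the generic induction `KLRegimeInductionP4` is universal in the
bundle `Pr` and the volume-limit slot).  Nothing else is asserted; nothing asserts superconductivity.
-/

noncomputable section

namespace Summit.HubbardSuperconductivity.HubbardSuperconductivity.Theorems.KLRegimeSplit

set_option linter.dupNamespace false -- summit = problem name (single-conjunct summit), D-0017

/-- **The K3-named glue at `klPredsV14` with the ∃-slot**: `EngineP4 klPredsV14 klWindowC`, `BetaSplitP klPredsV14 klWindowC`,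
`CountertermP2 klPredsV14 klWindowC`, `VolumeLimitP2 klPredsV14 FinalTwoLegVolLimitEx klWindowC`, `TwoPointAssemblyP3 klPredsV14 FinalTwoLegVolLimitEx klWindowC`
imply crux K3 `KLRegimeTwoPointLimit` BY NAME. -/
theorem KLRegimeInductionV14P4Ex :
    EngineP4 klPredsV14 klWindowC → BetaSplitP klPredsV14 klWindowC → CountertermP2 klPredsV14 klWindowC →
      VolumeLimitP2 klPredsV14 FinalTwoLegVolLimitEx klWindowC → TwoPointAssemblyP3 klPredsV14 FinalTwoLegVolLimitEx klWindowC →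
        Summit.HubbardSuperconductivity.HubbardSuperconductivity.Theses.KLProgramme.KLRegimeTwoPointLimit :=
  KLRegimeInductionP4 klPredsV14 FinalTwoLegVolLimitEx

end Summit.HubbardSuperconductivity.HubbardSuperconductivity.Theorems.KLRegimeSplit

end
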